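import Mathlib
import Summits.NavierStokesRegularity.NavierStokesRegularity.Theorems.FilamentSkeletonRssStadiumChordVariance
import Summits.NavierStokesRegularity.NavierStokesRegularity.Theorems.FilamentSkeletonRssStadiumCauchyNumerator
import Summits.NavierStokesRegularity.NavierStokesRegularity.Theorems.FilamentSkeletonRssStadiumPartnerPiece

/-!
# Route `FilamentSkeletonRss` · child crux `TangentSkeletonNearStraightL` (stmt-NavierStokesRegularity-23320) · registered line
# `child_tangent_analytic_strip_L` (b0b56c52900dd90a), stub `stub_stripPropagation` — assembly piece: SHORT SLOPED CHORDS (descent sources near the target)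

Fourth assembly piece of the quarter-width blueprint (evidence `CORNER-QUARTER-BLUEPRINT-leafhand-15-g0.md` on 23320): the cone version of
`Theorems.StadiumPlateauShortChord`.  In the stub's own terms (rectangle stadium `S`, `‖F′‖ ≤ M`, `Σ (F′)ᵢ² = 1`), for a target `z` and a
COMPLEX displacement `s` (a source on the descent of the contour) whose chord has fitting `d`-discs:
* `abs_affine_le_max` / `closedBall_cchord_subset` — discs about the chord fit as soon as they fit at both endpoints;
* `descent_chord_sq_sub_sq_le` — `‖Σᵢ (Fᵢ(z+s) − Fᵢ(z))² − s²‖ ≤ (M/d)²/4·‖s‖⁴` (`Theorems.StadiumCauchyNumerator` + `Theorems.StadiumChordVariance`);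
* `descent_chord_re_pos` — in the double cone `|Im s| ≤ λ|Re s|` with `(M/d)²/4·‖s‖²·(1+λ²) ≤ 1 − λ²`, `0 < κ`, `0 < g₀ ≤ Re G`:
  `0 < Re(Σᵢ (Fᵢ(z+s) − Fᵢ(z))² + κ·G)` — EVERY `Rb`, no tangent-deviation input.
HONEST FRAMING: bookkeeping for a HYPOTHETICAL filament skeleton on the NEGATIVE side of a MODEL route; the stub `stub_stripPropagation` is NOT
closed by this file; nothing here bears on Navier–Stokes regularity or blow-up.  `--supports stmt-NavierStokesRegularity-23320`.
-/

set_option linter.dupNamespace false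

noncomputable section

namespace Summit.NavierStokesRegularity.NavierStokesRegularity.Theorems.StadiumDescentShortChord

open Set Metric
open Summit.NavierStokesRegularity.NavierStokesRegularity.Theorems.StadiumChordVariance
open Summit.NavierStokesRegularity.NavierStokesRegularity.Theorems.StadiumCauchyNumerator
open Summit.NavierStokesRegularity.NavierStokesRegularity.Theorems.StadiumPartnerPiece

/-- An affine function on `[0,1]` is bounded in absolute value by its endpoint values. [folklore] -/
theorem abs_affine_le_max (a b : ℝ) {r : ℝ} (hr : r ∈ Icc (0:ℝ) 1) : |a + r * b| ≤ max (|a|) (|a + b|) := by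
  have h : a + r * b = (1 - r) * a + r * (a + b) := by ring
  rw [h]
  have h1 : 0 ≤ 1 - r := by linarith [hr.2]
  calc |(1 - r) * a + r * (a + b)| ≤ |(1 - r) * a| + |r * (a + b)| := abs_add_le _ _
    _ = (1 - r) * |a| + r * |a + b| := by rw [abs_mul, abs_mul, abs_of_nonneg h1, abs_of_nonneg hr.1]
    _ ≤ (1 - r) * max (|a|) (|a + b|) + r * max (|a|) (|a + b|) :=
        add_le_add (mul_le_mul_of_nonneg_left (le_max_left _ _) h1) (mul_le_mul_of_nonneg_left (le_max_right _ _) hr.1)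
    _ = max (|a|) (|a + b|) := by ring

/-- **Discs about a complex chord fit in the stadium** when they fit at both endpoints. [folklore] -/
theorem closedBall_cchord_subset {hs L cc d : ℝ} {z s : ℂ}
    (hv0 : |z.im| + d < hs) (hv1 : |(z + s).im| + d < hs)
    (hh0 : |z.re - cc| + d < L + hs) (hh1 : |(z + s).re - cc| + d < L + hs)
    {r : ℝ} (hr : r ∈ Icc (0:ℝ) 1) :
    closedBall (z + (r : ℂ) * s) d ⊆ {w : ℂ | |w.im| < hs ∧ |w.re - cc| < L + hs} := by
  intro w hw
  rw [mem_closedBall, dist_eq_norm] at hw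
  have him : |w.im - (z.im + r * s.im)| ≤ d := by
    have h := Complex.abs_im_le_norm (w - (z + (r : ℂ) * s))
    simp only [Complex.sub_im, Complex.add_im, Complex.mul_im, Complex.ofReal_re, Complex.ofReal_im, zero_mul,
      add_zero] at h
    exact h.trans hw
  have hre : |w.re - (z.re + r * s.re)| ≤ d := by
    have h := Complex.abs_re_le_norm (w - (z + (r : ℂ) * s))
    simp only [Complex.sub_re, Complex.add_re, Complex.mul_re, Complex.ofReal_re, Complex.ofReal_im, zero_mul,
      sub_zero] at h
    exact h.trans hw
  have hmi : |z.im + r * s.im| ≤ max (|z.im|) (|(z + s).im|) := by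
    have h := abs_affine_le_max z.im s.im hr
    simpa only [Complex.add_im] using h
  have hmr : |z.re - cc + r * s.re| ≤ max (|z.re - cc|) (|(z + s).re - cc|) := by
    have h := abs_affine_le_max (z.re - cc) s.re hr
    have e : z.re - cc + s.re = (z + s).re - cc := by simp [Complex.add_re]; ring
    rw [e] at h; exact h
  have hmaxi : max (|z.im|) (|(z + s).im|) + d < hs := by
    rcases le_total (|z.im|) (|(z + s).im|) with h | h
    · rw [max_eq_right h]; exact hv1
    · rw [max_eq_left h]; exact hv0
  have hmaxr : max (|z.re - cc|) (|(z + s).re - cc|) + d < L + hs := by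
    rcases le_total (|z.re - cc|) (|(z + s).re - cc|) with h | h
    · rw [max_eq_right h]; exact hh1
    · rw [max_eq_left h]; exact hh0
  refine ⟨?_, ?_⟩
  · have h3 := abs_le.1 him
    have h4 := abs_lt.1 (lt_of_le_of_lt hmi (by linarith : max (|z.im|) (|(z + s).im|) < hs - d))
    rw [abs_lt]; constructor <;> linarith
  · have h3 := abs_le.1 hre
    have h4 := abs_lt.1 (lt_of_le_of_lt hmr (by linarith : max (|z.re - cc|) (|(z + s).re - cc|) < L + hs - d))
    rw [abs_lt]; constructor <;> nlinarith

/-- **Short sloped chords: the second-order chord bound in the stub's terms.**  Stadium `S`, `F` holomorphic on `S` with `‖F′‖ ≤ M` and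
`Σ (F′)ᵢ² = 1`; target `z`, complex displacement `s`, fitting `d`-discs at both endpoints (`0 < d`): then
`‖Σᵢ (Fᵢ(z+s) − Fᵢ(z))² − s²‖ ≤ (M/d)²/4·‖s‖⁴`. [folklore] -/
theorem descent_chord_sq_sub_sq_le {hs L cc M d : ℝ} {F : ℂ → (Fin 3 → ℂ)}
    (hF : DifferentiableOn ℂ F {z : ℂ | |z.im| < hs ∧ |z.re - cc| < L + hs})
    (hM : ∀ z ∈ {z : ℂ | |z.im| < hs ∧ |z.re - cc| < L + hs}, ‖deriv F z‖ ≤ M)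
    (hunit : ∀ w ∈ {z : ℂ | |z.im| < hs ∧ |z.re - cc| < L + hs}, ∑ i, (deriv F w i) ^ 2 = 1)
    {z s : ℂ} (hd : 0 < d)
    (hv0 : |z.im| + d < hs) (hv1 : |(z + s).im| + d < hs)
    (hh0 : |z.re - cc| + d < L + hs) (hh1 : |(z + s).re - cc| + d < L + hs) :
    ‖(∑ i, (F (z + s) i - F z i) ^ 2) - s ^ 2‖ ≤ (M / d) ^ 2 / 4 * ‖s‖ ^ 4 := by
  set S : Set ℂ := {z : ℂ | |z.im| < hs ∧ |z.re - cc| < L + hs} with hS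
  have hSo : IsOpen S := isOpen_stadium hs (L + hs) cc
  have hball : ∀ r ∈ Icc (0:ℝ) 1, closedBall (z + (r : ℂ) * s) d ⊆ S := fun r hr =>
    closedBall_cchord_subset hv0 hv1 hh0 hh1 hr
  have hseg : ∀ r ∈ Icc (0:ℝ) 1, z + (r : ℂ) * s ∈ S := fun r hr => hball r hr (mem_closedBall_self hd.le)
  have hM2 : ∀ r ∈ Icc (0:ℝ) 1, ‖deriv (deriv F) (z + (r : ℂ) * s)‖ ≤ M / d := fun r hr =>
    norm_deriv_deriv_le_of_closedBall hSo hF hM hd (hball r hr)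
  exact chord_sq_sub_sq_norm_le_of_deriv_deriv hSo hF hunit hseg hM2

/-- **Principal branch on short sloped chords, every `Rb`.**  Under the hypotheses of `descent_chord_sq_sub_sq_le`, in the double cone
`|Im s| ≤ λ|Re s|` with `(M/d)²/4·‖s‖²·(1+λ²) ≤ 1 − λ²`, and with a core term `0 < κ`, `0 < g₀ ≤ Re Gv`:
`0 < Re(Σᵢ (Fᵢ(z+s) − Fᵢ(z))² + κ·Gv)`. [folklore] -/
theorem descent_chord_re_pos {hs L cc M d : ℝ} {F : ℂ → (Fin 3 → ℂ)}
    (hF : DifferentiableOn ℂ F {z : ℂ | |z.im| < hs ∧ |z.re - cc| < L + hs})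
    (hM : ∀ z ∈ {z : ℂ | |z.im| < hs ∧ |z.re - cc| < L + hs}, ‖deriv F z‖ ≤ M)
    (hunit : ∀ w ∈ {z : ℂ | |z.im| < hs ∧ |z.re - cc| < L + hs}, ∑ i, (deriv F w i) ^ 2 = 1)
    {z s : ℂ} (hd : 0 < d)
    (hv0 : |z.im| + d < hs) (hv1 : |(z + s).im| + d < hs)
    (hh0 : |z.re - cc| + d < L + hs) (hh1 : |(z + s).re - cc| + d < L + hs)
    {lam : ℝ} (hcone : |s.im| ≤ lam * |s.re|) (hshort : (M / d) ^ 2 / 4 * ‖s‖ ^ 2 * (1 + lam ^ 2) ≤ 1 - lam ^ 2)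
    {κ g₀ : ℝ} {Gv : ℂ} (hκ : 0 < κ) (hg₀ : 0 < g₀) (hG : g₀ ≤ Gv.re) :
    0 < ((∑ i, (F (z + s) i - F z i) ^ 2) + (κ : ℂ) * Gv).re := by
  set S : Set ℂ := {z : ℂ | |z.im| < hs ∧ |z.re - cc| < L + hs} with hS
  have hSo : IsOpen S := isOpen_stadium hs (L + hs) cc
  have hball : ∀ r ∈ Icc (0:ℝ) 1, closedBall (z + (r : ℂ) * s) d ⊆ S := fun r hr =>
    closedBall_cchord_subset hv0 hv1 hh0 hh1 hr
  have hseg : ∀ r ∈ Icc (0:ℝ) 1, z + (r : ℂ) * s ∈ S := fun r hr => hball r hr (mem_closedBall_self hd.le)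
  have hM2 : ∀ r ∈ Icc (0:ℝ) 1, ‖deriv (deriv F) (z + (r : ℂ) * s)‖ ≤ M / d := fun r hr =>
    norm_deriv_deriv_le_of_closedBall hSo hF hM hd (hball r hr)
  exact re_chord_add_core_pos_of_deriv_deriv hSo hF hunit hseg hM2 hcone hshort hκ hg₀ hG

end Summit.NavierStokesRegularity.NavierStokesRegularity.Theorems.StadiumDescentShortChord

end
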